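/-
Copyright (c) 2026 the pub-hodgecm-mathlib formalisation cell (harness21).  Prover seat hodgecm-mathlib-K2E4-p08 (g2), Track B «K2-LIT» ∕ h413, ‹S› ROAD J brick J1′, rung 1:
the invariant central singular junction WITH THE VALUE OF THE TRANSFER AT THE CENTRE.  2026-09-04.
-/
import Literature.NumberTheory.Rogawski1990.LocalTransferCentralSingularJunctionInvCM   -- ★ p841647: the (R-inv) junction; this file is its twin with the value at `ε_H` threaded through
import HarnessLib

/-!
# The central singular junction, invariant form, WITH THE VALUE AT THE CENTRE — road J brick J1′, rung 1

Twin of ★ `exists_nhds_stableOrbitalIntegralRel_eq_of_central_singular_inv` (p841647; [Rogawski1990, Prop. 8.2.1 (a)(d) ⟸ 8.1.3], [LanglandsShelstad1990Descent, Thm. 2.3.A,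
§2.4]) in which the two analytic binders also report the VALUE AT `ε_H` of the function they produce — `hD`: the descended `ψ_ε` has `ψ_ε(ε_H) = D_ε ψ`; `hI′`: the compact-side
`ψ′` has `ψ′(ε_H) = D_{ε′} ψ` — for two abstract functionals `D_ε, D_{ε′}` (in the application: `D_ε ψ = Φ(⟦ε⟧, ψ; ν_G ∕ θ_*ν_H)` by ★ J1 p855498
`exists_nhds_classOrbitalIntegral_dock_eq_and_apply_centre`, and `D_{ε′} ψ = Δ‴_v(ε_H, ε′)·f_EP(a·1)·Φ(⟦ε′⟧, ψ; ·)` by the compact-side junction with value over ★ J2♯ p855763), and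
the conclusion carries, besides `stub_N6nsS1`'s body VERBATIM, the extra conjunct **`φ^H(ε_H) = Δ‴_v(ε_H, ε)·D_ε φ + D_{ε′} φ`** — the transfer built by the junction is
`φ^H := Δ₀ • φ_ε + ψ′` and its value at the centre is read off.  The proof is p841647's, token for token, plus one `rw`.  This is the value conjunct that road J's step J5
(★ `transfer_apply_eq_of_local_identity` p855527 + B_loc + J3) turns into the SIGNED singular transfer ‹S›.

* **`exists_nhds_stableOrbitalIntegralRel_eq_and_apply_centre_of_central_singular_inv`**.

HONEST LABEL: a Literature-side helper toward h413 (`stmt-HodgeConjecture-24833`); HC_CM is proved only modulo its printed citations until rung 0 closes; this theorem is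
hypothesis-driven on its binders exactly like p841647.
-/

set_option autoImplicit false

noncomputable section

open Set Filter Topology MeasureTheory Polynomial
open scoped Pointwise Matrix

namespace Literature.NumberTheory.Rogawski1990

open Literature.NumberTheory.Automorphic Literature.NumberTheory.Automorphic.UnitaryGroup Literature.NumberTheory.GaloisRepresentations
open _root_.NumberField _root_.IsDedekindDomain

section CentralSingularInvValue

variable (L : Type) [Field L] [NumberField L] [IsCMField L] (H' : Matrix (Fin 3) (Fin 3) L) (v : HeightOneSpectrum (𝓞 ↥(maximalRealSubfield L)))

variable [iM' : ∀ γ : (cmDatum L 3 H').Local v, MeasurableSpace ((cmDatum L 3 H').Local v ⧸ Subgroup.centralizer ({γ} : Set ((cmDatum L 3 H').Local v)))]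
  [iH : ∀ a : ((cmDatum L 2 (Matrix.of fun i j : Fin 2 => if i.val + j.val + 1 = 2 then (1 : L) else 0)).Local v ×
      (cmDatum L 1 (Matrix.of fun i j : Fin 1 => if i.val + j.val + 1 = 1 then (1 : L) else 0)).Local v), MeasurableSpace (((cmDatum L 2 (Matrix.of fun i j : Fin 2 => if i.val + j.val + 1 = 2 then (1 : L) else 0)).Local v ×
      (cmDatum L 1 (Matrix.of fun i j : Fin 1 => if i.val + j.val + 1 = 1 then (1 : L) else 0)).Local v) ⧸ Subgroup.centralizer ({a} : Set ((cmDatum L 2 (Matrix.of fun i j : Fin 2 => if i.val + j.val + 1 = 2 then (1 : L) else 0)).Local v ×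
      (cmDatum L 1 (Matrix.of fun i j : Fin 1 => if i.val + j.val + 1 = 1 then (1 : L) else 0)).Local v)))]

variable [MeasurableSpace ((cmDatum L 2 (Matrix.of fun i j : Fin 2 => if i.val + j.val + 1 = 2 then (1 : L) else 0)).Local v ×
      (cmDatum L 1 (Matrix.of fun i j : Fin 1 => if i.val + j.val + 1 = 1 then (1 : L) else 0)).Local v)] [BorelSpace ((cmDatum L 2 (Matrix.of fun i j : Fin 2 => if i.val + j.val + 1 = 2 then (1 : L) else 0)).Local v ×
      (cmDatum L 1 (Matrix.of fun i j : Fin 1 => if i.val + j.val + 1 = 1 then (1 : L) else 0)).Local v)]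
  [iHB : ∀ a : ((cmDatum L 2 (Matrix.of fun i j : Fin 2 => if i.val + j.val + 1 = 2 then (1 : L) else 0)).Local v ×
      (cmDatum L 1 (Matrix.of fun i j : Fin 1 => if i.val + j.val + 1 = 1 then (1 : L) else 0)).Local v), BorelSpace (((cmDatum L 2 (Matrix.of fun i j : Fin 2 => if i.val + j.val + 1 = 2 then (1 : L) else 0)).Local v ×
      (cmDatum L 1 (Matrix.of fun i j : Fin 1 => if i.val + j.val + 1 = 1 then (1 : L) else 0)).Local v) ⧸ Subgroup.centralizer ({a} : Set ((cmDatum L 2 (Matrix.of fun i j : Fin 2 => if i.val + j.val + 1 = 2 then (1 : L) else 0)).Local v ×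
      (cmDatum L 1 (Matrix.of fun i j : Fin 1 => if i.val + j.val + 1 = 1 then (1 : L) else 0)).Local v)))]

/-- **`R_φ` IS A LOCAL STABLE ORBITAL INTEGRAL AT A CENTRAL `(G,H)`-REGULAR POINT, WITH THE VALUE OF THE TRANSFER AT THE CENTRE** (invariant form).  Binders of ★
`exists_nhds_stableOrbitalIntegralRel_eq_of_central_singular_inv` with `hD` ∕ `hI′` augmented by the values `ψ_ε(ε_H) = D_ε ψ`, `ψ′(ε_H) = D_{ε′} ψ`; conclusion = its conclusion
∧ `φ^H(ε_H) = Δ‴_v(ε_H, ε)·D_ε φ + D_{ε′} φ`. [cite: Rogawski1990, §8.2 Prop. 8.2.1 (a)(d) p. 112; §8.1 Prop. 8.1.3 pp. 110–111] [cite: LanglandsShelstad1990Descent, Thm. 2.3.A, §2.4] -/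
theorem exists_nhds_stableOrbitalIntegralRel_eq_and_apply_centre_of_central_singular_inv
    (hH' : (H'.map (cmConjRingHom L))ᵀ = H') (hdet' : H'.det ≠ 0) (μ : HeckeCharacter L)
    (hl : ∀ (v : HeightOneSpectrum (𝓞 ↥(maximalRealSubfield L))) (a : ((cmDatum L 2 (Matrix.of fun i j : Fin 2 => if i.val + j.val + 1 = 2 then (1 : L) else 0)).Local v ×
      (cmDatum L 1 (Matrix.of fun i j : Fin 1 => if i.val + j.val + 1 = 1 then (1 : L) else 0)).Local v)) (b : (cmDatum L 3 H').Local v) (x : ((cmDatum L 2 (Matrix.of fun i j : Fin 2 => if i.val + j.val + 1 = 2 then (1 : L) else 0)).Local v ×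
      (cmDatum L 1 (Matrix.of fun i j : Fin 1 => if i.val + j.val + 1 = 1 then (1 : L) else 0)).Local v)),
      finExplicitDelta L v H' (x * a * x⁻¹) μ b = finExplicitDelta L v H' a μ b)
    (hr : ∀ (v : HeightOneSpectrum (𝓞 ↥(maximalRealSubfield L))) (a : ((cmDatum L 2 (Matrix.of fun i j : Fin 2 => if i.val + j.val + 1 = 2 then (1 : L) else 0)).Local v ×
      (cmDatum L 1 (Matrix.of fun i j : Fin 1 => if i.val + j.val + 1 = 1 then (1 : L) else 0)).Local v)) (b y : (cmDatum L 3 H').Local v),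
      finExplicitDelta L v H' a μ (y * b * y⁻¹) = finExplicitDelta L v H' a μ b)
    (νH : Measure ((cmDatum L 2 (Matrix.of fun i j : Fin 2 => if i.val + j.val + 1 = 2 then (1 : L) else 0)).Local v ×
      (cmDatum L 1 (Matrix.of fun i j : Fin 1 => if i.val + j.val + 1 = 1 then (1 : L) else 0)).Local v)) [νH.IsHaarMeasure] [νH.IsMulRightInvariant]
    {mH : OrbitalMeasureFamily ((cmDatum L 2 (Matrix.of fun i j : Fin 2 => if i.val + j.val + 1 = 2 then (1 : L) else 0)).Local v ×
      (cmDatum L 1 (Matrix.of fun i j : Fin 1 => if i.val + j.val + 1 = 1 then (1 : L) else 0)).Local v)} {mG : OrbitalMeasureFamily ((cmDatum L 3 H').Local v)}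
    (hmH : mH.IsCanonical (IsLocalGRegular L v) νH)
    -- the central point and the dock at the good class `ε`
    (εH : ((cmDatum L 2 (Matrix.of fun i j : Fin 2 => if i.val + j.val + 1 = 2 then (1 : L) else 0)).Local v ×
      (cmDatum L 1 (Matrix.of fun i j : Fin 1 => if i.val + j.val + 1 = 1 then (1 : L) else 0)).Local v)) (ε : (cmDatum L 3 H').Local v) (y : GL (Fin 3) (LocalRing L v))
    (θ : ((cmDatum L 2 (Matrix.of fun i j : Fin 2 => if i.val + j.val + 1 = 2 then (1 : L) else 0)).Local v ×
      (cmDatum L 1 (Matrix.of fun i j : Fin 1 => if i.val + j.val + 1 = 1 then (1 : L) else 0)).Local v) ≃ₜ* ↥(Subgroup.centralizer ({ε} : Set ((cmDatum L 3 H').Local v))))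
    (hθ : ∀ z : ((cmDatum L 2 (Matrix.of fun i j : Fin 2 => if i.val + j.val + 1 = 2 then (1 : L) else 0)).Local v ×
      (cmDatum L 1 (Matrix.of fun i j : Fin 1 => if i.val + j.val + 1 = 1 then (1 : L) else 0)).Local v), (((θ z).1).val : GL (Fin 3) (LocalRing L v)) = y * ((endoEmbLocal L v z).val : GL (Fin 3) (LocalRing L v)) * y⁻¹)
    -- the `ε′`-side predicate (abstract; in the application: «unitarily conjugate into the frame of `ε′` with second block `γ₂`»)
    (Q' : ((cmDatum L 2 (Matrix.of fun i j : Fin 2 => if i.val + j.val + 1 = 2 then (1 : L) else 0)).Local v ×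
      (cmDatum L 1 (Matrix.of fun i j : Fin 1 => if i.val + j.val + 1 = 1 then (1 : L) else 0)).Local v) → (cmDatum L 3 H').Local v → Prop)
    -- (SEP′) on a stably saturated neighbourhood
    (hsep' : ∃ B₇ ∈ 𝓝 εH, (∀ h ∈ B₇, ∀ h' : ((cmDatum L 2 (Matrix.of fun i j : Fin 2 => if i.val + j.val + 1 = 2 then (1 : L) else 0)).Local v ×
      (cmDatum L 1 (Matrix.of fun i j : Fin 1 => if i.val + j.val + 1 = 1 then (1 : L) else 0)).Local v), IsLocalStablyConjH L v h h' → h' ∈ B₇) ∧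
      ∀ h ∈ B₇, ∀ h' ∈ B₇, ∀ x : (cmDatum L 3 H').Local v, x * ((θ h : ↥(Subgroup.centralizer ({ε} : Set ((cmDatum L 3 H').Local v)))) : (cmDatum L 3 H').Local v) * x⁻¹ = ((θ h' : ↥(Subgroup.centralizer ({ε} : Set ((cmDatum L 3 H').Local v)))) : (cmDatum L 3 H').Local v) → IsConj h h')
    -- the side dichotomy near `ε_H` and its exclusivity
    (hside : ∃ V₃ ∈ 𝓝 εH, ∀ γH ∈ V₃, IsLocalGRegular L v γH → ∀ γ' : (cmDatum L 3 H').Local v, IsLocalNormPair L H' v γH γ' →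
      (∃ x : (cmDatum L 3 H').Local v, ∃ h : ((cmDatum L 2 (Matrix.of fun i j : Fin 2 => if i.val + j.val + 1 = 2 then (1 : L) else 0)).Local v ×
      (cmDatum L 1 (Matrix.of fun i j : Fin 1 => if i.val + j.val + 1 = 1 then (1 : L) else 0)).Local v), IsLocalStablyConjH L v γH h ∧ x * γ' * x⁻¹ = ((θ h : ↥(Subgroup.centralizer ({ε} : Set ((cmDatum L 3 H').Local v)))) : (cmDatum L 3 H').Local v)) ∨ (∃ x : (cmDatum L 3 H').Local v, Q' γH (x * γ' * x⁻¹)))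
    (hdisj : ∃ V₀ ∈ 𝓝 εH, ∀ γH ∈ V₀, IsLocalGRegular L v γH → ∀ γ' : (cmDatum L 3 H').Local v,
      (∃ x : (cmDatum L 3 H').Local v, ∃ h : ((cmDatum L 2 (Matrix.of fun i j : Fin 2 => if i.val + j.val + 1 = 2 then (1 : L) else 0)).Local v ×
      (cmDatum L 1 (Matrix.of fun i j : Fin 1 => if i.val + j.val + 1 = 1 then (1 : L) else 0)).Local v), IsLocalStablyConjH L v γH h ∧ x * γ' * x⁻¹ = ((θ h : ↥(Subgroup.centralizer ({ε} : Set ((cmDatum L 3 H').Local v)))) : (cmDatum L 3 H').Local v)) → (∃ x : (cmDatum L 3 H').Local v, Q' γH (x * γ' * x⁻¹)) → False)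
    -- the VALUES AT THE CENTRE: two functionals (in the application: the orbital integrals of `ψ` at `ε` and, weighted by `Δ‴(ε_H, ε′)·f_EP(a·1)`, at `ε′`)
    (Dε Dε' : ((cmDatum L 3 H').Local v → ℂ) → ℂ)
    -- DESCENT at `ε` on a stably saturated neighbourhood, read on `H_v` through `θ`, WITH THE VALUE of the descended function at `ε_H`
    (hD : ∀ ψ : (cmDatum L 3 H').Local v → ℂ, IsLocSmooth ψ → ∃ B ∈ 𝓝 εH, (∀ h ∈ B, ∀ h' : ((cmDatum L 2 (Matrix.of fun i j : Fin 2 => if i.val + j.val + 1 = 2 then (1 : L) else 0)).Local v ×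
      (cmDatum L 1 (Matrix.of fun i j : Fin 1 => if i.val + j.val + 1 = 1 then (1 : L) else 0)).Local v), IsLocalStablyConjH L v h h' → h' ∈ B) ∧
      ∃ ψε : ((cmDatum L 2 (Matrix.of fun i j : Fin 2 => if i.val + j.val + 1 = 2 then (1 : L) else 0)).Local v ×
      (cmDatum L 1 (Matrix.of fun i j : Fin 1 => if i.val + j.val + 1 = 1 then (1 : L) else 0)).Local v) → ℂ, IsLocSmooth ψε ∧
      (∀ h ∈ B, IsLocalGRegular L v h → classOrbitalIntegral mG ψ (ConjClasses.mk ((θ h : ↥(Subgroup.centralizer ({ε} : Set ((cmDatum L 3 H').Local v)))) : (cmDatum L 3 H').Local v)) = classOrbitalIntegral mH ψε (ConjClasses.mk h)) ∧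
      ψε εH = Dε ψ)
    -- `Δ_v` along the dock on stable classes near `ε_H`
    (hΔθ : ∃ VΔ ∈ 𝓝 εH, ∀ γH ∈ VΔ, IsLocalGRegular L v γH → ∀ h : ((cmDatum L 2 (Matrix.of fun i j : Fin 2 => if i.val + j.val + 1 = 2 then (1 : L) else 0)).Local v ×
      (cmDatum L 1 (Matrix.of fun i j : Fin 1 => if i.val + j.val + 1 = 1 then (1 : L) else 0)).Local v), IsLocalStablyConjH L v γH h →
      finExplicitDelta L v H' γH μ ((θ h : ↥(Subgroup.centralizer ({ε} : Set ((cmDatum L 3 H').Local v)))) : (cmDatum L 3 H').Local v) = finExplicitDelta L v H' εH μ ε)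
    -- the `Q′`-side is a local stable orbital integral
    (hI' : ∀ ψ : (cmDatum L 3 H').Local v → ℂ, IsLocSmooth ψ → ∃ V₆ ∈ 𝓝 εH, ∃ ψ' : ((cmDatum L 2 (Matrix.of fun i j : Fin 2 => if i.val + j.val + 1 = 2 then (1 : L) else 0)).Local v ×
      (cmDatum L 1 (Matrix.of fun i j : Fin 1 => if i.val + j.val + 1 = 1 then (1 : L) else 0)).Local v) → ℂ, IsLocSmooth ψ' ∧ (∀ γH ∈ V₆, IsLocalGRegular L v γH →
      (∑ᶠ c ∈ {c : ConjClasses ((cmDatum L 3 H').Local v) | ∃ x : (cmDatum L 3 H').Local v, Q' γH (x * Quotient.out c * x⁻¹)},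
          ((finExplicitCollection L H' μ hl hr) v).Δ γH (Quotient.out c) * classOrbitalIntegral mG ψ c) =
        stableOrbitalIntegralRel (IsLocalStablyConjH L v) mH ψ' γH) ∧ ψ' εH = Dε' ψ)
    (φ : (cmDatum L 3 H').Local v → ℂ) (hφ : IsLocSmooth φ) :
    ∃ V ∈ 𝓝 εH, ∃ φH : ((cmDatum L 2 (Matrix.of fun i j : Fin 2 => if i.val + j.val + 1 = 2 then (1 : L) else 0)).Local v ×
      (cmDatum L 1 (Matrix.of fun i j : Fin 1 => if i.val + j.val + 1 = 1 then (1 : L) else 0)).Local v) → ℂ, IsLocSmooth φH ∧ (∀ γH ∈ V, IsLocalGRegular L v γH →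
      stableOrbitalIntegralRel (IsLocalStablyConjH L v) mH φH γH =
        ∑ᶠ c : ConjClasses ((cmDatum L 3 H').Local v), ((finExplicitCollection L H' μ hl hr) v).Δ γH (Quotient.out c) * classOrbitalIntegral mG φ c) ∧
      φH εH = finExplicitDelta L v H' εH μ ε * Dε φ + Dε' φ := by
  classical
  have hΔT : ∀ (a' : ((cmDatum L 2 (Matrix.of fun i j : Fin 2 => if i.val + j.val + 1 = 2 then (1 : L) else 0)).Local v ×
      (cmDatum L 1 (Matrix.of fun i j : Fin 1 => if i.val + j.val + 1 = 1 then (1 : L) else 0)).Local v)) (b : (cmDatum L 3 H').Local v), ((finExplicitCollection L H' μ hl hr) v).Δ a' b = finExplicitDelta L v H' a' μ b :=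
    fun a' b => finExplicitCollection_Δ L H' μ hl hr v a' b
  -- matching along the dock
  have hθm : ∀ h : ((cmDatum L 2 (Matrix.of fun i j : Fin 2 => if i.val + j.val + 1 = 2 then (1 : L) else 0)).Local v ×
      (cmDatum L 1 (Matrix.of fun i j : Fin 1 => if i.val + j.val + 1 = 1 then (1 : L) else 0)).Local v), IsLocalNormPair L H' v h ((θ h : ↥(Subgroup.centralizer ({ε} : Set ((cmDatum L 3 H').Local v)))) : (cmDatum L 3 H').Local v) := fun h => isConj_iff.2 ⟨y, (hθ h).symm⟩
  -- descent, separation, exclusivity, sides, `Δ`, the `ε′`-side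
  obtain ⟨B₄, hB₄, hB₄sat, φε, hφε, hdesc, hvalε⟩ := hD φ hφ
  obtain ⟨B₇, hB₇, hB₇sat, hsep⟩ := hsep'
  obtain ⟨V₃, hV₃, hsd⟩ := hside
  obtain ⟨V₀, hV₀, hdj⟩ := hdisj
  obtain ⟨VΔ, hVΔ, hΔ⟩ := hΔθ
  obtain ⟨V₆, hV₆, ψ', hψ', hI, hvalε'⟩ := hI' φ hφ
  -- the stably saturated «box» `B := B₄ ∩ B₇`
  set B : Set ((cmDatum L 2 (Matrix.of fun i j : Fin 2 => if i.val + j.val + 1 = 2 then (1 : L) else 0)).Local v ×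
      (cmDatum L 1 (Matrix.of fun i j : Fin 1 => if i.val + j.val + 1 = 1 then (1 : L) else 0)).Local v) := B₄ ∩ B₇ with hBdef
  have hB : B ∈ 𝓝 εH := inter_mem hB₄ hB₇
  have hBsat : ∀ h ∈ B, ∀ h' : ((cmDatum L 2 (Matrix.of fun i j : Fin 2 => if i.val + j.val + 1 = 2 then (1 : L) else 0)).Local v ×
      (cmDatum L 1 (Matrix.of fun i j : Fin 1 => if i.val + j.val + 1 = 1 then (1 : L) else 0)).Local v), IsLocalStablyConjH L v h h' → h' ∈ B :=
    fun h hh h' hst => ⟨hB₄sat h hh.1 h' hst, hB₇sat h hh.2 h' hst⟩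
  -- the transfer near `ε_H`
  set Δ₀ : ℂ := finExplicitDelta L v H' εH μ ε with hΔ₀
  have hsm : IsLocSmooth (Δ₀ • φε) :=
    (isLocSmooth_iff _).2 ⟨hφε.isLocallyConstant.comp fun z => Δ₀ * z, hφε.hasCompactSupport.mul_left⟩
  refine ⟨V₃ ∩ V₀ ∩ VΔ ∩ V₆ ∩ B, inter_mem (inter_mem (inter_mem (inter_mem hV₃ hV₀) hVΔ) hV₆) hB, Δ₀ • φε + ψ', hsm.add hψ', ?_, ?_⟩
  swap
  · -- the VALUE AT THE CENTRE: `φ^H(ε_H) = Δ₀ · φ_ε(ε_H) + ψ′(ε_H)`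
    rw [Pi.add_apply, Pi.smul_apply, smul_eq_mul, hvalε, hvalε']
  rintro γH ⟨⟨⟨⟨hγ₃, hγ₀⟩, hγΔ⟩, hγ₆⟩, hγB⟩ hγreg
  -- the summand and the two side predicates
  set F : ConjClasses ((cmDatum L 3 H').Local v) → ℂ := fun c =>
    ((finExplicitCollection L H' μ hl hr) v).Δ γH (Quotient.out c) * classOrbitalIntegral mG φ c with hFdef
  set Pε : ConjClasses ((cmDatum L 3 H').Local v) → Prop := fun c =>
    ∃ x : (cmDatum L 3 H').Local v, ∃ h ∈ B, IsLocalStablyConjH L v γH h ∧ x * Quotient.out c * x⁻¹ = ((θ h : ↥(Subgroup.centralizer ({ε} : Set ((cmDatum L 3 H').Local v)))) : (cmDatum L 3 H').Local v) with hPεdef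
  set Pε' : ConjClasses ((cmDatum L 3 H').Local v) → Prop := fun c => ∃ x : (cmDatum L 3 H').Local v, Q' γH (x * Quotient.out c * x⁻¹) with hPε'def
  have hFfin : (Function.support F).Finite :=
    finite_support_delta_mul_classOrbitalIntegral_of_isLocSmooth L H' v hH' hdet' _ mG φ hφ γH hγreg
  -- (1) split `F = 1_ε F + 1_{ε′} F` (the side dichotomy + exclusivity; unmatched classes carry `Δ = 0`)
  have hsplit : ∀ c, F c = (if Pε c then F c else 0) + (if Pε' c then F c else 0) := by
    intro c
    by_cases hR : IsLocalNormPair L H' v γH (Quotient.out c)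
    · rcases hsd γH hγ₃ hγreg _ hR with ⟨x, h, hst, hx⟩ | ⟨x, hx⟩
      · have hP : Pε c := ⟨x, h, hBsat γH hγB h hst, hst, hx⟩
        have hnP : ¬ Pε' c := fun h' => hdj γH hγ₀ hγreg _ ⟨x, h, hst, hx⟩ h'
        rw [if_pos hP, if_neg hnP, add_zero]
      · have hP : Pε' c := ⟨x, hx⟩
        have hnP : ¬ Pε c := fun ⟨x', h, _, hst, hx'⟩ => hdj γH hγ₀ hγreg _ ⟨x', h, hst, hx'⟩ ⟨x, hx⟩
        rw [if_neg hnP, if_pos hP, zero_add]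
    · have hF0 : F c = 0 := by
        simp only [hFdef, hΔT, finExplicitDelta_of_not_isLocalNormPair L v H' γH μ hR, zero_mul]
      simp only [hF0, ite_self, add_zero]
  have hfin₁ : (Function.support fun c => if Pε c then F c else 0).Finite :=
    hFfin.subset fun c hc => by
      simp only [Function.mem_support, ne_eq, ite_eq_right_iff, Classical.not_imp] at hc ⊢
      exact hc.2
  have hfin₂ : (Function.support fun c => if Pε' c then F c else 0).Finite :=
    hFfin.subset fun c hc => by
      simp only [Function.mem_support, ne_eq, ite_eq_right_iff, Classical.not_imp] at hc ⊢
      exact hc.2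
  have hsum : (∑ᶠ c, F c) = (∑ᶠ c, if Pε c then F c else 0) + ∑ᶠ c, if Pε' c then F c else 0 := by
    rw [← finsum_add_distrib hfin₁ hfin₂]
    exact finsum_congr hsplit
  have hite : ∀ P : ConjClasses ((cmDatum L 3 H').Local v) → Prop, (∑ᶠ c, if P c then F c else 0) = ∑ᶠ c ∈ {c | P c}, F c := by
    intro P
    rw [finsum_mem_def]
    exact finsum_congr fun c => (Set.indicator_apply _ _ _).symm
  -- (2) the `ε′`-side is `Φ^st(γ_H, ψ′)` by (Iε′)
  have hε'side : (∑ᶠ c, if Pε' c then F c else 0) = stableOrbitalIntegralRel (IsLocalStablyConjH L v) mH ψ' γH := by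
    rw [hite]; exact hI γH hγ₆ hγreg
  -- (3) the ε-side is `Δ₀ · Φ^st(γ_H, φ_ε)` (★ bookkeeping lemma of the box junction; saturation into `B` is the identity conjugator)
  have hregB : ∀ h, IsLocalStablyConjH L v γH h → IsLocalGRegular L v h := fun h hst => isGRegular_of_isStablyConjH _ _ _ _ hst hγreg
  have hsatB : ∀ γH' : ((cmDatum L 2 (Matrix.of fun i j : Fin 2 => if i.val + j.val + 1 = 2 then (1 : L) else 0)).Local v ×
      (cmDatum L 1 (Matrix.of fun i j : Fin 1 => if i.val + j.val + 1 = 1 then (1 : L) else 0)).Local v), IsLocalStablyConjH L v γH γH' → ∃ x : ((cmDatum L 2 (Matrix.of fun i j : Fin 2 => if i.val + j.val + 1 = 2 then (1 : L) else 0)).Local v ×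
      (cmDatum L 1 (Matrix.of fun i j : Fin 1 => if i.val + j.val + 1 = 1 then (1 : L) else 0)).Local v), x * γH' * x⁻¹ ∈ B :=
    fun γH' hst => ⟨1, by rw [one_mul, inv_one, mul_one]; exact hBsat γH hγB γH' hst⟩
  have hΔB : ∀ h ∈ B, IsLocalStablyConjH L v γH h → finExplicitDelta L v H' γH μ ((θ h : ↥(Subgroup.centralizer ({ε} : Set ((cmDatum L 3 H').Local v)))) : (cmDatum L 3 H').Local v) = Δ₀ :=
    fun h _ hst => hΔ γH hγΔ hγreg h hst
  have hεside : (∑ᶠ c, if Pε c then F c else 0) = Δ₀ * stableOrbitalIntegralRel (IsLocalStablyConjH L v) mH φε γH := by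
    rw [hite]
    exact finsum_mem_side_eq_mul_stableOrbitalIntegralRel L H' v μ hl hr mH mG θ γH B φ φε Δ₀ hsatB
      (fun h hh h' hh' x hx => hsep h hh.2 h' hh'.2 x hx) hΔB
      (fun h hhB hst => hdesc h hhB.1 (hregB h hst))
  -- (4) assemble: `Φ^st(γ_H, Δ₀ • φ_ε + ψ′) = Δ₀ Φ^st(γ_H, φ_ε) + Φ^st(γ_H, ψ′)`
  rw [hsum, hεside, hε'side, ← stableOrbitalIntegralRel_smul_fun]
  exact localStableOrbitalIntegralH_add_of_isLocSmooth L v (OrbitalMeasureFamily.IsCanonical.isAdmissibleOn hmH)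
    γH hγreg _ _ hsm hψ'

end CentralSingularInvValue

end Literature.NumberTheory.Rogawski1990

end
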